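import Summits.FinalStateConjecture.FinalStateConjecture.Theorems.SwallowTheDatumParametricKerrBurialEngine
import Summits.FinalStateConjecture.FinalStateConjecture.Theorems.SwallowTheDatumBurialIntoShieldedBackground

/-!
# `ParametricKerrBurial`, line `receding-annulus-universal-collar` — stub `stub_collar_of_locatedPlug` (S5b)

Stub S5b of the lead's skeleton for crux `stmt-FinalStateConjecture-10052`
(`Summit.FinalStateConjecture.FinalStateConjecture.Theses.SwallowTheDatum.ParametricKerrBurial`): from the LOCATED PLUG
(hypothesis 1: PlugData `(M, ρ₃, D₀)` ↦ an admissible vacuum datum `D` on `E3` which IS `D₀` on the core ball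
`{‖y‖ < M/32}` and is Kerr-shielded by a chart ranging in `{‖y‖ > M}`) and PlugData⁺ (hypothesis 2: such `D₀` carrying,
at a scale `λ` with `2λ < ρ₃ < M/40`, the exact annulus `(λ⁻²(1 + λμ/2|y|)⁴ δ, 0)` on `{λ < |y| < 2λ}`, `0 < μ ≤ μ₀`) to
the universal collar (B): an admissible datum `C` on `E3` with `IsSchwarzschildAnnulus C μ` and `IsKerrShieldedAway 2 C`.

The proof is a PURE PULL-BACK along the linear dilation `Λ = λ • id` of `ℝ³`: `C := Λ^* D` (`InitialDataSet.comap`).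
* admissibility is diffeomorphism invariant (`BurialIntoShieldedBackground.comap_mem_admissibleVacuumData`);
* the located shield is diffeomorphism covariant (`isKerrShieldedAway_comap`, the located version of
  `BurialIntoShieldedBackground.isKerrShielded_comap`: the new chart is `Λ⁻¹ ∘ φ`, ranging in `{‖y‖ > M/λ} ⊆ {‖y‖ > 2}`);
* on `{1 < ‖y‖ < 2}`: `(Λ^* h)_y(v, w) = h_{λy}(λv, λw) = λ² · λ⁻² (1 + λμ/(2λ‖y‖))⁴ ⟪v, w⟫ = (1 + μ/(2‖y‖))⁴ ⟪v, w⟫` and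
  `(Λ^* k)_y = 0`, since `λ < ‖λ y‖ < 2λ < M/32` lies in the core ball where `D = D₀`.

References: R. Bartnik, J. Isenberg, *The constraint equations* (2004), §2 (diffeomorphism equivariance of data);
B. O'Neill, *Semi-Riemannian Geometry* (1983), Ch. 3, p. 58; the lead's skeleton `work/ParametricKerrBurial.lean` (v7).
-/

-- the doubled `FinalStateConjecture` path component is the summit/problem naming scheme, not a mistake
set_option linter.dupNamespace false

noncomputable section

namespace Summit.FinalStateConjecture.FinalStateConjecture.Theorems.SwallowTheDatum.ParametricKerrBurial

open scoped Manifold ContDiff Topology BigOperators InnerProductSpace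
open Bundle Set Filter Function MeasureTheory Literature.Geometry.Lorentzian
open Literature.Geometry.Lorentzian.MaoOhTao Literature.Geometry.Lorentzian.InitialDataSet
open BurialIntoShieldedBackground (contMDiff_linear injective_mfderiv_linear mfderiv_linear_apply
  comap_mem_admissibleVacuumData)

/-! ## §1 Diffeomorphism covariance of the LOCATED shielding predicate -/

/-- **Diffeomorphism covariance of `IsKerrShieldedAway`** (the located version of
`BurialIntoShieldedBackground.isKerrShielded_comap`). Let `Θ : E3 ≅ E3` be a diffeomorphism with `ρ' < ‖Θ⁻¹ y‖`
whenever `ρ < ‖y‖`, and `D` a datum on `E3` which is Kerr-shielded through `(M, a, r₁, T, φ, ψ, ν)` with `φ` ranging in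
`{‖y‖ > ρ}`.  Then `Θ^* D` is Kerr-shielded through `(M, a, r₁, T, Θ⁻¹ ∘ φ, ψ, ν)`, and `Θ⁻¹ ∘ φ` ranges in
`{‖y‖ > ρ'}`; the pull-back identities are the chain rule `(Θ⁻¹ ∘ φ)^* (Θ^* h) = φ^* h` (`pullbackBilin_comp`).
O'Neill 1983, Ch. 3, p. 58; Bartnik–Isenberg 2004, §2. [folklore] -/
theorem isKerrShieldedAway_comap [Kerr.Facts] (Θ : Diffeomorph (𝓡 3) (𝓡 3) E3 E3 ∞)
    (hΘ : ContMDiff (𝓡 3) (𝓡 3) (∞ + 1) Θ) (hΘ' : ∀ u, Injective (mfderiv (𝓡 3) (𝓡 3) Θ u)) {ρ ρ' : ℝ}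
    (hloc : ∀ y : E3, ρ < ‖y‖ → ρ' < ‖Θ.symm y‖) {D : InitialDataSet (𝓡 3) E3} (hD : IsKerrShieldedAway ρ D) :
    IsKerrShieldedAway ρ' (D.comap Θ hΘ hΘ') := by
  -- adapted from `BurialIntoShieldedBackground.isKerrShielded_comap` (same witnesses; the located clause added)
  obtain ⟨M, a, r₁, hM, T, φ, ψ, ν, hρ, haM, hr₁, hr₂, hT, hK, hφ, hφs, hψ, hsp, hfun, hh, hk⟩ := hD
  set φ' : Kerr.slice a r₁ → E3 := Θ.symm ∘ φ with hφ'
  have hφ's : ContMDiff 𝓘(ℝ, E3) (𝓡 3) ∞ φ' := Θ.symm.contMDiff.comp hφs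
  have hΘd : MDifferentiable (𝓡 3) (𝓡 3) Θ := Θ.contMDiff.mdifferentiable (by simp)
  have hφ'd : MDifferentiable 𝓘(ℝ, E3) (𝓡 3) φ' := hφ's.mdifferentiable (by simp)
  have hcomp : (Θ : E3 → E3) ∘ φ' = φ := by
    funext y
    simp [hφ']
  refine ⟨M, a, r₁, hM, T, φ', ψ, ν, fun z ↦ hloc (φ z) (hρ z), haM, hr₁, hr₂, hT, ?_, ?_, hφ's, hψ, hsp,
    hfun, ?_, ?_⟩
  · -- compact complement of the range
    have hr : (Set.range φ')ᶜ = Θ.symm '' (Set.range φ)ᶜ := by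
      rw [hφ', Set.range_comp]
      exact (Set.image_compl_eq (f := (Θ.symm : E3 → E3)) Θ.symm.toEquiv.bijective).symm
    rw [hr]
    exact hK.image Θ.symm.continuous
  · -- open embedding
    exact Θ.symm.toHomeomorph.isOpenEmbedding.comp hφ
  · -- the metric clause
    intro y
    have h1 : (D.comap Θ hΘ hΘ').h.inner = pullbackBilin (I := 𝓡 3) (I' := 𝓡 3) Θ D.h.inner := by
      funext u
      ext v w
      rfl
    rw [h1, ← congrFun (pullbackBilin_comp (I := 𝓡 3) (I' := 𝓘(ℝ, E3)) (I'' := 𝓡 3) hΘd hφ'd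
      D.h.inner) y, hcomp]
    exact hh y
  · -- the second-fundamental-form clause
    intro _ y
    have h1 : (D.comap Θ hΘ hΘ').k = pullbackBilin (I := 𝓡 3) (I' := 𝓡 3) Θ D.k := rfl
    rw [h1, ← congrFun (pullbackBilin_comp (I := 𝓡 3) (I' := 𝓘(ℝ, E3)) (I'' := 𝓡 3) hΘd hφ'd
      D.k) y, hcomp]
    exact hk y

/-! ## §2 The stub -/

/-- **STUB S5b `stub_collar_of_locatedPlug`** (pure pull-back dilation): from the located plug and PlugData⁺ to the universal
collar — pull the admissible located-shielded datum back along `y ↦ λ y` (`comap_mem_admissibleVacuumData`,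
`isKerrShieldedAway_comap`: the chart `λ⁻¹ φ` ranges in `{‖y‖ > M/λ} ⊆ {‖y‖ > 2}`), so that the annulus
`λ⁻²(1 + λμ/2‖y‖)⁴ δ` on `{λ < ‖y‖ < 2λ} ⊆ {‖y‖ < M/32}` becomes `IsSchwarzschildAnnulus · μ`. [folklore] -/
theorem stub_collar_of_locatedPlug :
    (∀ [Kerr.Facts] (M ρ₃ : ℝ) (D₀ : InitialDataSet (𝓡 3) E3), 0 < M → 0 < ρ₃ → ρ₃ < M / 40 →
      (∀ [D₀.metric.HasLeviCivita], D₀.IsVacuumConstraintSolution) →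
      (∀ y : E3, ρ₃ < ‖y‖ →
        (∀ v w : E3, D₀.h.inner y v w = Schwarzschild.conformalFactor M y ^ 4 * ⟪v, w⟫_ℝ) ∧ D₀.k y = 0) →
      ∃ D ∈ admissibleVacuumData E3,
        (∀ y : E3, ‖y‖ < M / 32 → D.h.inner y = D₀.h.inner y ∧ D.k y = D₀.k y) ∧ IsKerrShieldedAway M D) →
    (∀ μ₀ : ℝ, 0 < μ₀ → PlugDataPlusAt μ₀) →
    (∀ [Kerr.Facts], ∀ μ₀ : ℝ, 0 < μ₀ → ∃ μ : ℝ, 0 < μ ∧ μ ≤ μ₀ ∧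
      ∃ C ∈ admissibleVacuumData E3, IsSchwarzschildAnnulus C μ ∧ IsKerrShieldedAway 2 C) := by
  intro hplug hPD _ μ₀ hμ₀
  obtain ⟨μ, M, ρ₃, lam, D₀, hμ, hμle, hM, hρ₃, hρ₃M, hlam, h2lam, hvac, hexact, hann⟩ := hPD μ₀ hμ₀
  obtain ⟨D, hDadm, hcore, hsh⟩ := hplug M ρ₃ D₀ hM hρ₃ hρ₃M hvac hexact
  -- the linear dilation `Λ = λ • id` of `ℝ³`
  set A : E3 ≃L[ℝ] E3 := (LinearEquiv.smulOfNeZero ℝ E3 lam hlam.ne').toContinuousLinearEquiv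
  have hAy : ∀ y : E3, A y = lam • y := fun y ↦ rfl
  have hAsy : ∀ y : E3, A.symm y = lam⁻¹ • y := fun y ↦ rfl
  have hnorm : ∀ y : E3, ‖lam • y‖ = lam * ‖y‖ := fun y ↦ by
    rw [norm_smul, Real.norm_of_nonneg hlam.le]
  refine ⟨μ, hμ, hμle, D.comap A (contMDiff_linear A) (injective_mfderiv_linear A),
    comap_mem_admissibleVacuumData A.toDiffeomorph (contMDiff_linear A) (injective_mfderiv_linear A) hDadm,
    fun y h1 h2 ↦ ?_, ?_⟩
  · -- the Schwarzschild(`μ`) annulus on `{1 < ‖y‖ < 2}`, read in the core ball where `D = D₀`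
    have hy1 : lam < ‖lam • y‖ := by rw [hnorm]; nlinarith
    have hy2 : ‖lam • y‖ < 2 * lam := by rw [hnorm]; nlinarith
    have hyc : ‖lam • y‖ < M / 32 := by linarith
    obtain ⟨hhD, hkD⟩ := hcore (lam • y) hyc
    obtain ⟨hh₀, hk₀⟩ := hann (lam • y) hy1 hy2
    have hny : ‖y‖ ≠ 0 := by
      have : 0 < ‖y‖ := by linarith
      exact this.ne'
    have hl0 : lam ≠ 0 := hlam.ne'
    have hcoef : lam * μ / (2 * (lam * ‖y‖)) = μ / (2 * ‖y‖) := by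
      rw [mul_left_comm 2 lam, mul_div_mul_left _ _ hl0]
    -- the scalar identity `λ² · λ⁻² (1 + λμ/(2λ‖y‖))⁴ ⟪v, w⟫ = (1 + μ/(2‖y‖))⁴ ⟪v, w⟫`
    have key : ∀ v w : E3, D.h.inner (lam • y) (lam • v) (lam • w) = (1 + μ / (2 * ‖y‖)) ^ 4 * ⟪v, w⟫_ℝ := by
      intro v w
      rw [hhD, hh₀, real_inner_smul_left, real_inner_smul_right, hnorm, hcoef]
      field_simp
    constructor
    · ext v w
      rw [comap_h_inner, mfderiv_linear_apply, mfderiv_linear_apply]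
      exact key v w
    · ext v w
      rw [comap_k, mfderiv_linear_apply, mfderiv_linear_apply, hAy, hAy, hAy, hkD, hk₀]
      rfl
  · -- the located shield: the chart `λ⁻¹ φ` ranges in `{‖y‖ > M/λ} ⊆ {‖y‖ > 2}` (`80 λ < M`)
    refine isKerrShieldedAway_comap A.toDiffeomorph (contMDiff_linear A) (injective_mfderiv_linear A)
      (fun y hy ↦ ?_) hsh
    rw [ContinuousLinearEquiv.coe_toDiffeomorph_symm, hAsy, norm_smul,
      Real.norm_of_nonneg (inv_nonneg.2 hlam.le), lt_inv_mul_iff₀ hlam]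
    linarith

end Summit.FinalStateConjecture.FinalStateConjecture.Theorems.SwallowTheDatum.ParametricKerrBurial

end
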